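import Summits.QuantumFields.BalabanUV.T4Continuum.Support.B13ReadingsLineProductsSecond

/-!
# B13ReadingsAvgTowerSecondBavg — row NE5, junction J-avg-reg SECOND ORDER (R60), abstract half, file 4: letter (ℓ4) `hbavgD` of
# `NE2FromNE3BavgBridge.localRate_regClass_of_bavg_consistent` AT ONE LEVEL — the BLOCK-AVERAGE CONSISTENCY OF THE DERIVATIVE TOWER
# `‖bavg (dconnTower R (k+1) μ) i − dconnTower R k μ i‖ ≤ γD∕lev L k` from: levelwise regularity (α, β), the averaging structure at `i`
# and at `τ_μ⁻¹ i` (corrected straight-line products, the line starting IN THE BLOCK of `i`, the two lines `L` fine steps apart), the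
# correction letter `κ` and the correction-SHIFT letter `κ₁`, and the second-order Lipschitz letter `βD′` of the level-`(k+1)` derivative
# tower: `γD = (2d+2)·βD′ + e^{α∕ℓ}(κ₁ + κβ∕ℓ + αβ)`

Cell `pub-balaban`, unit `b2b-balaban-t4-ne5-p1` (row NE5 OWNER, gen 40; owner item «g40-σ» FILE B, INTENT `HOME/CLAIMS.log` l.25382; T4-DAG
Q52; RULING R60; GAPS § G-ne5p1-Javg-reg UPDATE 1).  Summits-side NEW WORK under the LEAN PLACEMENT RULE: [folklore] normed-ring and lattice
bookkeeping on the ABSTRACT towers of rows NE2 ∕ B5; 0 `def`, no `Prop`-valued fact, nothing printed asserted, no citation tag.  HONEST FRAMING: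
rung (B)+1 of the FINITE-VOLUME T⁴ programme — NOT infinite volume, NOT a mass gap, NOT the Clay problem, NOT a proof of NE5 (NOT PRINTED; GAPS
G-t4-U3-1), NOT a proof of NE2; every letter is a hypothesis; the k-uniform END over `FactorisationData` + `SecondOrderLetters` (βD′ from
`B13ReadingsAvgTowerSecondUniform.hlipD_of_factorisation`) is the next file.  HONEST DEPENDENCY (cell, verbatim): continuum YM on T⁴ ⇐ BetaPertH
∧ nine spine estimates (0/9 proved); BetaPertH ⇐ (D1) ∧ (D4) ∧ CAP+tail; G-an2-4 gates asym, D1 and NE2/3/4.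

WHAT.
* §1 (normed ring) `norm_rem_sub_rem_le`: the SECOND-ORDER REMAINDERS `Π f − 1 − Σ(f_t − 1)` of two factor families with factors within
  `e` of `1` and `‖f_t − g_t‖ ≤ δ` differ by `≤ (1+e)^n·n²·e·δ`; `norm_corrRem_sub_corrRem_le`: with correction factors `‖C″ − 1‖ ≤ κc`,
  `‖C − C″‖ ≤ κΔ`, the corrected remainders `C·Π f − 1 − Σ(f_t − 1)` differ by `≤ (1+e)^n·(κΔ + κc·n·δ + n²·e·δ)`.
* §2 (lattice) `connTower_sub_tstep_eq_sum`: `w(y) − w(y − m e_μ) = Σ_{u<m} ℓ⁻¹•D_μw_μ(y − u e_μ)`; §3 the double line average of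
  `D_μw^{(k+1)}_μ` vs its block average (`(2d+2)·L·lip`), and the scaled line means' difference = that double average.
* §4 (level `k`) `bavgD_consistent_of_corrLines`: `D_μw^{(k)}_μ(i) = ℓ•(w^{(k)}(i) − w^{(k)}(τ_μ⁻¹ i))`, each `w^{(k)}` = line mean +
  corrected remainder (`B13ReadingsLineProducts`); line means ⟶ §3; remainders ⟶ §1 at `e = α∕ℓ′`, `δ = Lβ∕ℓ′²`, `κc = κ∕ℓ²`, `κΔ = κ₁∕ℓ³`.
0 sorry; axioms ⊆ {propext, Classical.choice, Quot.sound}.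
-/

noncomputable section

open scoped BigOperators Matrix Matrix.Norms.L2Operator

namespace Summit.QuantumFields.BalabanUV.T4Continuum.B13ReadingsAvgTowerSecondBavg

open Summit.QuantumFields.BalabanUV.T4Continuum.B13ReadingsLineProducts (lprod lprod_succ norm_lprod_sub_lprod_le norm_lprod_sub_one_le
  lineMean lineMean_eq_smul_sum norm_sub_one_le_of_scaled)
open Summit.QuantumFields.BalabanUV.T4Continuum.B13ReadingsLineProductsSecond (norm_lprod_sub_one_add_one_le)

/-! ## §1 Second-order remainders of two close factor families -/

section Products

variable {A : Type*} [NormedRing A]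

/-- [folklore] **THE SECOND-ORDER REMAINDERS OF TWO CLOSE FAMILIES**: factors within `e` of `1`, `‖f_t − g_t‖ ≤ δ` ⟹
`‖(Π f − 1 − Σ(f_t − 1)) − (Π g − 1 − Σ(g_t − 1))‖ ≤ (1 + e)^n · n² · e · δ`.  Induction on
`Δrem_{n+1} = Δrem_n + (P^f_n − P^g_n)(f_n − 1) + (P^g_n − 1)(f_n − g_n)`. -/
theorem norm_rem_sub_rem_le {f g : ℕ → A} {e δ : ℝ} {n : ℕ} (hf : ∀ t < n, ‖f t - 1‖ ≤ e) (hg : ∀ t < n, ‖g t - 1‖ ≤ e)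
    (hδ : ∀ t < n, ‖f t - g t‖ ≤ δ) :
    ‖(lprod f n - 1 - ∑ t ∈ Finset.range n, (f t - 1)) - (lprod g n - 1 - ∑ t ∈ Finset.range n, (g t - 1))‖
      ≤ (1 + e) ^ n * ((n : ℝ) ^ 2 * e * δ) := by
  induction n with
  | zero => simp
  | succ n ih =>
    have hf' : ∀ t < n, ‖f t - 1‖ ≤ e := fun t ht => hf t (Nat.lt_succ_of_lt ht)
    have hg' : ∀ t < n, ‖g t - 1‖ ≤ e := fun t ht => hg t (Nat.lt_succ_of_lt ht)
    have hδ' : ∀ t < n, ‖f t - g t‖ ≤ δ := fun t ht => hδ t (Nat.lt_succ_of_lt ht)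
    have he : 0 ≤ e := (norm_nonneg _).trans (hf n (Nat.lt_succ_self n))
    have hδ0 : 0 ≤ δ := (norm_nonneg _).trans (hδ n (Nat.lt_succ_self n))
    have h1e : 1 ≤ 1 + e := le_add_of_nonneg_right he
    have hpow : 0 ≤ (1 + e) ^ n := pow_nonneg (by linarith) n
    have hD := ih hf' hg' hδ'
    -- `‖P^f_n − P^g_n‖ ≤ (1+e)^n·n·δ`
    have hPfg : ‖lprod f n - lprod g n‖ ≤ (1 + e) ^ n * (n * δ) := by
      refine (norm_lprod_sub_lprod_le hf' hg').trans (mul_le_mul_of_nonneg_left ?_ hpow)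
      calc ∑ t ∈ Finset.range n, ‖f t - g t‖ ≤ ∑ _t ∈ Finset.range n, δ := Finset.sum_le_sum fun t ht => hδ' t (Finset.mem_range.1 ht)
        _ = n * δ := by rw [Finset.sum_const, Finset.card_range, nsmul_eq_mul]
    -- `‖P^g_n − 1‖ ≤ (1+e)^n − 1 ≤ n·e·(1+e)^n`
    have hPg1 : ‖lprod g n - 1‖ ≤ (1 + e) ^ n * (n * e) := by
      have h1 := norm_lprod_sub_one_add_one_le hg'
      have hgeom : (1 + e) ^ n - 1 = (∑ t ∈ Finset.range n, (1 + e) ^ t) * e := by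
        have h := geom_sum_mul (1 + e) n
        rw [add_sub_cancel_left] at h
        exact h.symm
      have hsum : ∑ t ∈ Finset.range n, (1 + e) ^ t ≤ n * (1 + e) ^ n := by
        calc ∑ t ∈ Finset.range n, (1 + e) ^ t ≤ ∑ _t ∈ Finset.range n, (1 + e) ^ n :=
              Finset.sum_le_sum fun t ht => pow_le_pow_right₀ h1e (Finset.mem_range.1 ht).le
          _ = n * (1 + e) ^ n := by rw [Finset.sum_const, Finset.card_range, nsmul_eq_mul]
      calc ‖lprod g n - 1‖ ≤ (1 + e) ^ n - 1 := by linarith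
        _ = (∑ t ∈ Finset.range n, (1 + e) ^ t) * e := hgeom
        _ ≤ (n * (1 + e) ^ n) * e := mul_le_mul_of_nonneg_right hsum he
        _ = (1 + e) ^ n * (n * e) := by ring
    rw [lprod_succ, lprod_succ, Finset.sum_range_succ, Finset.sum_range_succ]
    have key : (lprod f n * f n - 1 - (∑ t ∈ Finset.range n, (f t - 1) + (f n - 1)))
          - (lprod g n * g n - 1 - (∑ t ∈ Finset.range n, (g t - 1) + (g n - 1)))
        = ((lprod f n - 1 - ∑ t ∈ Finset.range n, (f t - 1)) - (lprod g n - 1 - ∑ t ∈ Finset.range n, (g t - 1)))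
          + (lprod f n - lprod g n) * (f n - 1) + (lprod g n - 1) * (f n - g n) := by
      noncomm_ring
    rw [key]
    calc ‖((lprod f n - 1 - ∑ t ∈ Finset.range n, (f t - 1)) - (lprod g n - 1 - ∑ t ∈ Finset.range n, (g t - 1)))
          + (lprod f n - lprod g n) * (f n - 1) + (lprod g n - 1) * (f n - g n)‖
        ≤ ‖(lprod f n - 1 - ∑ t ∈ Finset.range n, (f t - 1)) - (lprod g n - 1 - ∑ t ∈ Finset.range n, (g t - 1))‖
          + ‖lprod f n - lprod g n‖ * ‖f n - 1‖ + ‖lprod g n - 1‖ * ‖f n - g n‖ :=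
          (norm_add_le _ _).trans (add_le_add ((norm_add_le _ _).trans (add_le_add le_rfl (norm_mul_le _ _))) (norm_mul_le _ _))
      _ ≤ (1 + e) ^ n * ((n : ℝ) ^ 2 * e * δ) + (1 + e) ^ n * (n * δ) * e + (1 + e) ^ n * (n * e) * δ := by
          gcongr
          · exact hf n (Nat.lt_succ_self n)
          · exact hδ n (Nat.lt_succ_self n)
      _ = (1 + e) ^ n * (e * δ * ((n : ℝ) ^ 2 + 2 * n)) := by ring
      _ ≤ ((1 + e) ^ n * (1 + e)) * ((((n + 1 : ℕ) : ℝ)) ^ 2 * e * δ) := by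
          push_cast
          have hA : (1 + e) ^ n ≤ (1 + e) ^ n * (1 + e) := le_mul_of_one_le_right hpow h1e
          have hB : e * δ * ((n : ℝ) ^ 2 + 2 * n) ≤ ((n : ℝ) + 1) ^ 2 * e * δ := by nlinarith [mul_nonneg he hδ0]
          exact mul_le_mul hA hB (by positivity) (by positivity)
      _ = (1 + e) ^ (n + 1) * ((((n + 1 : ℕ) : ℝ)) ^ 2 * e * δ) := by ring

/-- [folklore] **THE CORRECTED SECOND-ORDER REMAINDERS OF TWO CLOSE FAMILIES**: with, moreover, correction factors `‖C″ − 1‖ ≤ κc` and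
`‖C − C″‖ ≤ κΔ`: `‖(C·Π f − 1 − Σ(f_t − 1)) − (C″·Π g − 1 − Σ(g_t − 1))‖ ≤ (1 + e)^n · (κΔ + κc·n·δ + n²·e·δ)` — the decomposition
`(C − C″)·Π f + (C″ − 1)·(Π f − Π g) + (rem f − rem g)`. -/
theorem norm_corrRem_sub_corrRem_le {f g : ℕ → A} {e δ κc κΔ : ℝ} {n : ℕ} (hf : ∀ t < n, ‖f t - 1‖ ≤ e) (hg : ∀ t < n, ‖g t - 1‖ ≤ e)
    (hδ : ∀ t < n, ‖f t - g t‖ ≤ δ) {C C'' : A} (hC'' : ‖C'' - 1‖ ≤ κc) (hCC : ‖C - C''‖ ≤ κΔ) :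
    ‖(C * lprod f n - 1 - ∑ t ∈ Finset.range n, (f t - 1)) - (C'' * lprod g n - 1 - ∑ t ∈ Finset.range n, (g t - 1))‖
      ≤ (1 + e) ^ n * (κΔ + κc * (n * δ) + (n : ℝ) ^ 2 * e * δ) := by
  have hκc : 0 ≤ κc := (norm_nonneg _).trans hC''
  have hκΔ : 0 ≤ κΔ := (norm_nonneg _).trans hCC
  have hD := norm_rem_sub_rem_le hf hg hδ
  have hPf1 : ‖lprod f n - 1‖ + 1 ≤ (1 + e) ^ n := norm_lprod_sub_one_add_one_le hf
  have hpow : 0 ≤ (1 + e) ^ n := le_trans (by positivity) hPf1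
  have hPfg : ‖lprod f n - lprod g n‖ ≤ (1 + e) ^ n * (n * δ) := by
    refine (norm_lprod_sub_lprod_le hf hg).trans (mul_le_mul_of_nonneg_left ?_ hpow)
    calc ∑ t ∈ Finset.range n, ‖f t - g t‖ ≤ ∑ _t ∈ Finset.range n, δ := Finset.sum_le_sum fun t ht => hδ t (Finset.mem_range.1 ht)
      _ = n * δ := by rw [Finset.sum_const, Finset.card_range, nsmul_eq_mul]
  have key : (C * lprod f n - 1 - ∑ t ∈ Finset.range n, (f t - 1)) - (C'' * lprod g n - 1 - ∑ t ∈ Finset.range n, (g t - 1))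
      = ((C - C'') * (lprod f n - 1) + (C - C'')) + (C'' - 1) * (lprod f n - lprod g n)
        + ((lprod f n - 1 - ∑ t ∈ Finset.range n, (f t - 1)) - (lprod g n - 1 - ∑ t ∈ Finset.range n, (g t - 1))) := by
    noncomm_ring
  rw [key]
  calc ‖((C - C'') * (lprod f n - 1) + (C - C'')) + (C'' - 1) * (lprod f n - lprod g n)
        + ((lprod f n - 1 - ∑ t ∈ Finset.range n, (f t - 1)) - (lprod g n - 1 - ∑ t ∈ Finset.range n, (g t - 1)))‖
      ≤ (‖C - C''‖ * ‖lprod f n - 1‖ + ‖C - C''‖) + ‖C'' - 1‖ * ‖lprod f n - lprod g n‖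
        + ‖(lprod f n - 1 - ∑ t ∈ Finset.range n, (f t - 1)) - (lprod g n - 1 - ∑ t ∈ Finset.range n, (g t - 1))‖ :=
        (norm_add_le _ _).trans (add_le_add ((norm_add_le _ _).trans (add_le_add ((norm_add_le _ _).trans
          (add_le_add (norm_mul_le _ _) le_rfl)) (norm_mul_le _ _))) le_rfl)
    _ = ‖C - C''‖ * (‖lprod f n - 1‖ + 1) + ‖C'' - 1‖ * ‖lprod f n - lprod g n‖
        + ‖(lprod f n - 1 - ∑ t ∈ Finset.range n, (f t - 1)) - (lprod g n - 1 - ∑ t ∈ Finset.range n, (g t - 1))‖ := by ring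
    _ ≤ κΔ * (1 + e) ^ n + κc * ((1 + e) ^ n * (n * δ)) + (1 + e) ^ n * ((n : ℝ) ^ 2 * e * δ) := by
        gcongr
    _ = (1 + e) ^ n * (κΔ + κc * (n * δ) + (n : ℝ) ^ 2 * e * δ) := by ring

end Products

/-! ## §2 Telescoping of the backward lattice derivative along its own direction -/

section Lattice

open Literature.MathematicalPhysics.QuantumFieldTheory.Balaban1983to89.B5Prop11Plancherel (fine Tor unitVec)
open Literature.MathematicalPhysics.QuantumFieldTheory.Balaban1983to89.B5Block118 (tstep tstep_zero tstep_succ)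
open Literature.MathematicalPhysics.QuantumFieldTheory.Balaban1983to89.B5G183RateUnitTower (lev lev_neZero)
open Summit.QuantumFields.BalabanUV.T4Continuum.BalabanAveragedTowerUnit (idx one_le_lev')
open Summit.QuantumFields.BalabanUV.T4Continuum.AbelianCovariantLaplacian (tauInv)
open Summit.QuantumFields.BalabanUV.T4Continuum.RegularBackgroundTower (connTower dconnTower)

variable {d : ℕ} (L : ℕ) [NeZero L] (M : Fin d → ℕ)
variable {o : Type*} [Fintype o] [DecidableEq o]

omit [Fintype o] in
/-- [folklore] **TELESCOPING**: `w_μ(y) − w_μ(y − m e_μ) = Σ_{u<m} ℓ⁻¹•D_μw_μ(y − u e_μ)` for the backward derivative tower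
`D_μw_μ = ℓ•(w_μ − w_μ∘τ_μ⁻¹)`, `ℓ = lev L k`. -/
theorem connTower_sub_tstep_eq_sum (R : (k : ℕ) → Fin d → (idx L M k → Matrix o o ℂ)) (k : ℕ) (μ : Fin d)
    (y : Tor (fine (lev L k) M)) (c : Fin d) : ∀ m : ℕ,
    connTower L M R k μ (y, c) - connTower L M R k μ (y - tstep (fine (lev L k) M) μ m, c)
      = ∑ u ∈ Finset.range m, (((lev L k : ℕ) : ℂ))⁻¹ • dconnTower L M R k μ (y - tstep (fine (lev L k) M) μ u, c)
  | 0 => by rw [tstep_zero, sub_zero, sub_self, Finset.sum_range_zero]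
  | m + 1 => by
    have hℓ : ((lev L k : ℕ) : ℂ) ≠ 0 := by exact_mod_cast Nat.pos_iff_ne_zero.1 (one_le_lev' L k)
    have h1 : tauInv (fine (lev L k) M) μ (y - tstep (fine (lev L k) M) μ m, c) = (y - tstep (fine (lev L k) M) μ (m + 1), c) := by
      rw [tstep_succ]; exact Prod.ext (sub_sub _ _ _) rfl
    rw [Finset.sum_range_succ, ← connTower_sub_tstep_eq_sum R k μ y c m, dconnTower, h1, smul_smul, inv_mul_cancel₀ hℓ, one_smul]
    abel

end Lattice

/-! ## §3 Two lattice lemmas at level `k+1`: the double line average vs the block average; the line means' difference -/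

section Tower

open Literature.MathematicalPhysics.QuantumFieldTheory.Balaban1983to89.B5Prop11Plancherel (fine Tor unitVec)
open Literature.MathematicalPhysics.QuantumFieldTheory.Balaban1983to89.B5Block118 (tstep tstep_zero tstep_succ)
open Literature.MathematicalPhysics.QuantumFieldTheory.Balaban1983to89.B5G183RateTorus (cpt)
open Literature.MathematicalPhysics.QuantumFieldTheory.Balaban1983to89.B5G183RateTorusW (off)
open Literature.MathematicalPhysics.QuantumFieldTheory.Balaban1983to89.B5G183RateUnitTower (lev lev_neZero)
open Summit.QuantumFields.BalabanUV.T4Continuum.BalabanAveragedTowerUnit (idx one_le_lev' cast_lev' lev_succ')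
open Summit.QuantumFields.BalabanUV.T4Continuum.BlockPairingGeometry (tau)
open Summit.QuantumFields.BalabanUV.T4Continuum.AbelianCovariantLaplacian (tauInv tau_tauInv tauInv_tau)
open Summit.QuantumFields.BalabanUV.T4Continuum.CovariantLinePlanting (bavg)
open Summit.QuantumFields.BalabanUV.T4Continuum.RegularBackgroundTower (RegularTransporters connTower dconnTower connTower_eq)
open Summit.QuantumFields.BalabanUV.T4Continuum.NE2FromNE3BavgBridge (norm_sub_tstep_le norm_sub_of_block_le norm_bavg_sub_le)
open Summit.QuantumFields.BalabanUV.T4Continuum.B13ReadingsAvgTowerDirect (norm_R_tau_sub_le)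

variable {d : ℕ} (L : ℕ) [NeZero L] (M : Fin d → ℕ) [hM : ∀ μ, NeZero (M μ)]
variable {o : Type*} [Fintype o] [DecidableEq o]

omit hM in
/-- [folklore] **THE DOUBLE LINE AVERAGE VS THE BLOCK AVERAGE**: for a lattice-Lipschitz level-`(k+1)` family `a` (`lip` per fine step), the
double average `L⁻² Σ_{t,u<L} a(s + (t − u)e_μ)` along the `μ`-line through the block member `s = cpt i.1 + off j₀` is within
`(2d+2)·L·lip` of the block average `bavg a i` (block diameter `2dL` + line offsets `|t − u| < L`, twice). -/
theorem norm_bavg_sub_doubleAvg_le {k : ℕ} (a : Tor (fine (L * lev L k) M) × Fin d → Matrix o o ℂ) {lip : ℝ} (hlip0 : 0 ≤ lip)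
    (hlip : ∀ ν x, ‖a (tau (fine (L * lev L k) M) ν x) - a x‖ ≤ lip) (μ : Fin d) (i : idx L M k) (j₀ : Fin d → Fin L) :
    ‖bavg (lev L k) L M a i - (((L : ℕ) : ℂ)⁻¹ * ((L : ℕ) : ℂ)⁻¹) • ∑ t ∈ Finset.range L, ∑ u ∈ Finset.range L,
        a (cpt (lev L k) L M i.1 + off (lev L k) L M j₀ + tstep (fine (L * lev L k) M) μ t - tstep (fine (L * lev L k) M) μ u, i.2)‖
      ≤ (2 * d + 2) * L * lip := by
  have hL : 0 < L := Nat.pos_of_ne_zero (NeZero.ne L)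
  have hLr : (0 : ℝ) < L := by exact_mod_cast hL
  have hcard : (Finset.range L).card = L := Finset.card_range L
  set s : Tor (fine (L * lev L k) M) := cpt (lev L k) L M i.1 + off (lev L k) L M j₀ with hs
  refine norm_bavg_sub_le a i _ fun j => ?_
  -- each of the `L²` averaged values is within the bound of the block member `cpt i.1 + off j`
  have hterm : ∀ t ∈ Finset.range L, ∀ u ∈ Finset.range L,
      ‖a (cpt (lev L k) L M i.1 + off (lev L k) L M j, i.2) - a (s + tstep (fine (L * lev L k) M) μ t - tstep (fine (L * lev L k) M) μ u, i.2)‖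
        ≤ (2 * d + 2) * L * lip := by
    intro t ht u hu
    have ht' : (t : ℝ) ≤ L := by exact_mod_cast (Finset.mem_range.1 ht).le
    have hu' : (u : ℝ) ≤ L := by exact_mod_cast (Finset.mem_range.1 hu).le
    have hblock : ‖a (cpt (lev L k) L M i.1 + off (lev L k) L M j, i.2) - a (s, i.2)‖ ≤ 2 * (d * L * lip) :=
      norm_sub_of_block_le a hlip0 hlip i.1 i.2 j j₀
    have e1 : s + tstep (fine (L * lev L k) M) μ t - tstep (fine (L * lev L k) M) μ u
        = (s - tstep (fine (L * lev L k) M) μ u) + tstep (fine (L * lev L k) M) μ t := by abel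
    have e2 : (s - tstep (fine (L * lev L k) M) μ u) + tstep (fine (L * lev L k) M) μ u = s := sub_add_cancel _ _
    have hzu : ‖a (s, i.2) - a (s - tstep (fine (L * lev L k) M) μ u, i.2)‖ ≤ u * lip := by
      have h1 := norm_sub_tstep_le a hlip (s - tstep (fine (L * lev L k) M) μ u) i.2 μ u
      rw [e2] at h1; exact h1
    have hzt : ‖a (s - tstep (fine (L * lev L k) M) μ u, i.2) - a (s - tstep (fine (L * lev L k) M) μ u + tstep (fine (L * lev L k) M) μ t, i.2)‖
        ≤ t * lip := by
      rw [norm_sub_rev]; exact norm_sub_tstep_le a hlip (s - tstep (fine (L * lev L k) M) μ u) i.2 μ t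
    rw [e1]
    calc ‖a (cpt (lev L k) L M i.1 + off (lev L k) L M j, i.2) - a (s - tstep (fine (L * lev L k) M) μ u + tstep (fine (L * lev L k) M) μ t, i.2)‖
        ≤ ‖a (cpt (lev L k) L M i.1 + off (lev L k) L M j, i.2) - a (s, i.2)‖
          + (‖a (s, i.2) - a (s - tstep (fine (L * lev L k) M) μ u, i.2)‖
            + ‖a (s - tstep (fine (L * lev L k) M) μ u, i.2) - a (s - tstep (fine (L * lev L k) M) μ u + tstep (fine (L * lev L k) M) μ t, i.2)‖) :=
          (norm_sub_le_norm_sub_add_norm_sub _ _ _).trans (add_le_add le_rfl (norm_sub_le_norm_sub_add_norm_sub _ _ _))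
      _ ≤ 2 * (d * L * lip) + (u * lip + t * lip) := add_le_add hblock (add_le_add hzu hzt)
      _ ≤ 2 * (d * L * lip) + (L * lip + L * lip) :=
          add_le_add le_rfl (add_le_add (mul_le_mul_of_nonneg_right hu' hlip0) (mul_le_mul_of_nonneg_right ht' hlip0))
      _ = (2 * d + 2) * L * lip := by ring
  have hw : a (cpt (lev L k) L M i.1 + off (lev L k) L M j, i.2)
      = (((L : ℕ) : ℂ)⁻¹ * ((L : ℕ) : ℂ)⁻¹) • ∑ _t ∈ Finset.range L, ∑ _u ∈ Finset.range L,
          a (cpt (lev L k) L M i.1 + off (lev L k) L M j, i.2) := by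
    rw [Finset.sum_const, Finset.sum_const, hcard, ← Nat.cast_smul_eq_nsmul ℂ, ← Nat.cast_smul_eq_nsmul ℂ, smul_smul, smul_smul]
    have hLc : ((L : ℕ) : ℂ) ≠ 0 := by exact_mod_cast hL.ne'
    rw [show ((L : ℕ) : ℂ)⁻¹ * ((L : ℕ) : ℂ)⁻¹ * ((L : ℕ) : ℂ) * ((L : ℕ) : ℂ) = 1 by field_simp, one_smul]
  rw [hw, ← smul_sub, ← Finset.sum_sub_distrib]
  simp_rw [← Finset.sum_sub_distrib]
  rw [norm_smul, norm_mul, norm_inv, Complex.norm_natCast]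
  calc (L : ℝ)⁻¹ * (L : ℝ)⁻¹ * ‖∑ t ∈ Finset.range L, ∑ u ∈ Finset.range L,
          (a (cpt (lev L k) L M i.1 + off (lev L k) L M j, i.2) - a (s + tstep (fine (L * lev L k) M) μ t - tstep (fine (L * lev L k) M) μ u, i.2))‖
      ≤ (L : ℝ)⁻¹ * (L : ℝ)⁻¹ * ∑ t ∈ Finset.range L, ∑ u ∈ Finset.range L,
          ‖a (cpt (lev L k) L M i.1 + off (lev L k) L M j, i.2) - a (s + tstep (fine (L * lev L k) M) μ t - tstep (fine (L * lev L k) M) μ u, i.2)‖ :=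
        mul_le_mul_of_nonneg_left ((norm_sum_le _ _).trans (Finset.sum_le_sum fun t _ => norm_sum_le _ _)) (by positivity)
    _ ≤ (L : ℝ)⁻¹ * (L : ℝ)⁻¹ * ∑ t ∈ Finset.range L, ∑ _u ∈ Finset.range L, (2 * d + 2) * L * lip :=
        mul_le_mul_of_nonneg_left (Finset.sum_le_sum fun t ht => Finset.sum_le_sum fun u hu => hterm t ht u hu) (by positivity)
    _ = (2 * d + 2) * L * lip := by
        rw [Finset.sum_const, Finset.sum_const, hcard, nsmul_eq_mul, nsmul_eq_mul]; field_simp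

variable {R : (k : ℕ) → Fin d → (idx L M k → Matrix o o ℂ)} {α β : ℝ}

omit hM in
/-- [folklore] **THE LINE MEANS OF TWO LINES `L` FINE STEPS APART, SCALED BY `ℓ`, TELESCOPE INTO THE DOUBLE LINE AVERAGE OF THE DERIVATIVE**:
`ℓ•(lineMean_s − lineMean_{s − L e_μ}) = L⁻² Σ_{t,u<L} D_μw^{(k+1)}_μ(s + (t − u)e_μ)` (`lineMean` of `B13ReadingsLineProducts` IS
`L⁻¹ Σ_t w^{(k+1)}_μ(line t)`; §2). -/
theorem smul_lineMean_sub_lineMean_eq (R : (k : ℕ) → Fin d → (idx L M k → Matrix o o ℂ)) (k : ℕ) (μ : Fin d)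
    (s : Tor (fine (L * lev L k) M)) (c : Fin d) :
    ((lev L k : ℕ) : ℂ) • (lineMean (L * lev L k) L (fun t => R (k + 1) μ (s + tstep (fine (L * lev L k) M) μ t, c))
        - lineMean (L * lev L k) L (fun t => R (k + 1) μ (s - tstep (fine (L * lev L k) M) μ L + tstep (fine (L * lev L k) M) μ t, c)))
      = (((L : ℕ) : ℂ)⁻¹ * ((L : ℕ) : ℂ)⁻¹) • ∑ t ∈ Finset.range L, ∑ u ∈ Finset.range L,
          dconnTower L M R (k + 1) μ (s + tstep (fine (L * lev L k) M) μ t - tstep (fine (L * lev L k) M) μ u, c) := by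
  have hL : 0 < L := Nat.pos_of_ne_zero (NeZero.ne L)
  have hLc : ((L : ℕ) : ℂ) ≠ 0 := by exact_mod_cast hL.ne'
  have hℓc : ((lev L k : ℕ) : ℂ) ≠ 0 := by exact_mod_cast Nat.pos_iff_ne_zero.1 (one_le_lev' L k)
  have hlmf : lineMean (L * lev L k) L (fun t => R (k + 1) μ (s + tstep (fine (L * lev L k) M) μ t, c))
      = ((L : ℕ) : ℂ)⁻¹ • ∑ t ∈ Finset.range L, connTower L M R (k + 1) μ (s + tstep (fine (L * lev L k) M) μ t, c) := rfl
  have hlmg : lineMean (L * lev L k) L (fun t => R (k + 1) μ (s - tstep (fine (L * lev L k) M) μ L + tstep (fine (L * lev L k) M) μ t, c))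
      = ((L : ℕ) : ℂ)⁻¹ • ∑ t ∈ Finset.range L, connTower L M R (k + 1) μ
          (s - tstep (fine (L * lev L k) M) μ L + tstep (fine (L * lev L k) M) μ t, c) := rfl
  have hterm : ∀ t ∈ Finset.range L, connTower L M R (k + 1) μ (s + tstep (fine (L * lev L k) M) μ t, c)
        - connTower L M R (k + 1) μ (s - tstep (fine (L * lev L k) M) μ L + tstep (fine (L * lev L k) M) μ t, c)
      = ∑ u ∈ Finset.range L, (((L * lev L k : ℕ) : ℂ))⁻¹ •
          dconnTower L M R (k + 1) μ (s + tstep (fine (L * lev L k) M) μ t - tstep (fine (L * lev L k) M) μ u, c) := by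
    intro t _
    rw [show s - tstep (fine (L * lev L k) M) μ L + tstep (fine (L * lev L k) M) μ t
        = s + tstep (fine (L * lev L k) M) μ t - tstep (fine (L * lev L k) M) μ L by abel]
    exact connTower_sub_tstep_eq_sum L M R (k + 1) μ (s + tstep (fine (L * lev L k) M) μ t) c L
  rw [hlmf, hlmg, ← smul_sub, ← Finset.sum_sub_distrib, smul_smul, Finset.sum_congr rfl hterm]
  simp_rw [← Finset.smul_sum]
  rw [smul_smul]
  congr 1
  rw [Nat.cast_mul]; field_simp

/-! ## §4 (ℓ4) at one level: block-average consistency of the derivative tower -/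

omit hM in
/-- [folklore] **(ℓ4) BLOCK-AVERAGE CONSISTENCY OF THE DERIVATIVE TOWER AT LEVEL `k`** — the `hbavgD` letter of
`NE2FromNE3BavgBridge.localRate_regClass_of_bavg_consistent` at that level — from: levelwise regularity `h` (sizes `α`, Lipschitz `β`); the
averaging structure at `i` (`R k μ i = C·Π_t R (k+1) μ (s + t e_μ)`, the line starting IN THE BLOCK of `i`: `s = cpt i.1 + off j₀`) and at
`τ_μ⁻¹ i` (correction `C″`, the line starting at `s − L e_μ`); the correction letter `‖C″ − 1‖ ≤ κ∕ℓ²`, the correction-SHIFT letter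
`‖C − C″‖ ≤ κ₁∕ℓ³`; and the second-order Lipschitz letter of the level-`(k+1)` derivative tower `‖D_μw′_μ(y + e_ν) − D_μw′_μ(y)‖ ≤ βD′∕ℓ′`:
`‖bavg (dconnTower R (k+1) μ) i − dconnTower R k μ i‖ ≤ ((2d+2)·βD′ + e^{α∕ℓ}·(κ₁ + κβ∕ℓ + αβ))∕ℓ`, `ℓ = lev L k`. -/
theorem bavgD_consistent_of_corrLines (h : RegularTransporters L M R α β) {κ κ₁ βD' : ℝ} {k : ℕ} {μ : Fin d} {i : idx L M k}
    {C C'' : Matrix o o ℂ} {j₀ : Fin d → Fin L}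
    (hstruct : R k μ i = C * lprod (fun t => R (k + 1) μ
      (cpt (lev L k) L M i.1 + off (lev L k) L M j₀ + tstep (fine (L * lev L k) M) μ t, i.2)) L)
    (hstruct'' : R k μ (tauInv (fine (lev L k) M) μ i) = C'' * lprod (fun t => R (k + 1) μ
      (cpt (lev L k) L M i.1 + off (lev L k) L M j₀ - tstep (fine (L * lev L k) M) μ L + tstep (fine (L * lev L k) M) μ t, i.2)) L)
    (hC'' : ‖C'' - 1‖ ≤ κ / ((lev L k : ℕ) : ℝ) ^ 2) (hCC : ‖C - C''‖ ≤ κ₁ / ((lev L k : ℕ) : ℝ) ^ 3)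
    (hlipD' : ∀ (ν : Fin d) (y : idx L M (k + 1)), ‖dconnTower L M R (k + 1) μ (tau (fine (lev L (k + 1)) M) ν y)
      - dconnTower L M R (k + 1) μ y‖ ≤ βD' / (lev L (k + 1) : ℕ)) :
    ‖bavg (lev L k) L M (dconnTower L M R (k + 1) μ) i - dconnTower L M R k μ i‖
      ≤ ((2 * d + 2) * βD' + Real.exp (α / (lev L k : ℕ)) * (κ₁ + κ * β / (lev L k : ℕ) + α * β)) / (lev L k : ℕ) := by
  have hL : 0 < L := Nat.pos_of_ne_zero (NeZero.ne L)
  have hLr : (0 : ℝ) < L := by exact_mod_cast hL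
  have hℓ1 := one_le_lev' L k
  have hℓ : (1 : ℝ) ≤ (lev L k : ℕ) := by exact_mod_cast hℓ1
  have hℓ0 : (0 : ℝ) < (lev L k : ℕ) := by linarith
  have hℓ'nat : 0 < L * lev L k := Nat.mul_pos hL hℓ1
  have hℓ' : (0 : ℝ) < ((L * lev L k : ℕ) : ℝ) := by exact_mod_cast hℓ'nat
  have hℓ'eq : ((L * lev L k : ℕ) : ℝ) = L * (lev L k : ℕ) := by rw [Nat.cast_mul]
  have hα : 0 ≤ α := h.nonneg.1
  have hβ : 0 ≤ β := h.nonneg.2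
  have hκ : 0 ≤ κ := by
    have h0 := (norm_nonneg _).trans hC''; rw [le_div_iff₀ (by positivity), zero_mul] at h0; exact h0
  have hκ₁ : 0 ≤ κ₁ := by
    have h0 := (norm_nonneg _).trans hCC; rw [le_div_iff₀ (by positivity), zero_mul] at h0; exact h0
  -- names: the start site, the two factor families
  set s : Tor (fine (L * lev L k) M) := cpt (lev L k) L M i.1 + off (lev L k) L M j₀ with hs
  set f : ℕ → Matrix o o ℂ := fun t => R (k + 1) μ (s + tstep (fine (L * lev L k) M) μ t, i.2) with hf
  set g : ℕ → Matrix o o ℂ := fun t => R (k + 1) μ (s - tstep (fine (L * lev L k) M) μ L + tstep (fine (L * lev L k) M) μ t, i.2) with hg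
  -- the Lipschitz letter of the level-(k+1) derivative in the `L·lev L k` currency, and its nonnegativity
  have hlipa : ∀ (ν : Fin d) (y : Tor (fine (L * lev L k) M) × Fin d),
      ‖dconnTower L M R (k + 1) μ (tau (fine (L * lev L k) M) ν y) - dconnTower L M R (k + 1) μ y‖ ≤ βD' / ((L * lev L k : ℕ) : ℝ) :=
    fun ν y => hlipD' ν y
  have hlip0 : 0 ≤ βD' / ((L * lev L k : ℕ) : ℝ) := (norm_nonneg _).trans (hlipa μ (s, i.2))
  -- level-(k+1) letters of the factors
  have hef : ∀ t < L, ‖f t - 1‖ ≤ α / ((L * lev L k : ℕ) : ℝ) := fun t _ => norm_sub_one_le_of_scaled hℓ'nat (h.size (k + 1) μ _)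
  have heg : ∀ t < L, ‖g t - 1‖ ≤ α / ((L * lev L k : ℕ) : ℝ) := fun t _ => norm_sub_one_le_of_scaled hℓ'nat (h.size (k + 1) μ _)
  have hδ : ∀ t < L, ‖f t - g t‖ ≤ L * (β / ((L * lev L k : ℕ) : ℝ) / ((L * lev L k : ℕ) : ℝ)) := by
    intro t _
    show ‖R (k + 1) μ (s + tstep (fine (L * lev L k) M) μ t, i.2)
        - R (k + 1) μ (s - tstep (fine (L * lev L k) M) μ L + tstep (fine (L * lev L k) M) μ t, i.2)‖ ≤ _
    have h1 : ‖R (k + 1) μ (s - tstep (fine (L * lev L k) M) μ L + tstep (fine (L * lev L k) M) μ t + tstep (fine (L * lev L k) M) μ L, i.2)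
        - R (k + 1) μ (s - tstep (fine (L * lev L k) M) μ L + tstep (fine (L * lev L k) M) μ t, i.2)‖
          ≤ L * (β / ((L * lev L k : ℕ) : ℝ) / ((L * lev L k : ℕ) : ℝ)) :=
      norm_sub_tstep_le (R (k + 1) μ) (fun ν x => norm_R_tau_sub_le L M h k μ ν x)
        (s - tstep (fine (L * lev L k) M) μ L + tstep (fine (L * lev L k) M) μ t) i.2 μ L
    have e1 : s - tstep (fine (L * lev L k) M) μ L + tstep (fine (L * lev L k) M) μ t + tstep (fine (L * lev L k) M) μ L
        = s + tstep (fine (L * lev L k) M) μ t := by abel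
    rw [e1] at h1
    exact h1
  -- (1) the derivative at level k = scaled line means' difference + scaled corrected remainders' difference
  set Ef := ((lev L k : ℕ) : ℂ) • (C * lprod f L - 1) - lineMean (L * lev L k) L f with hEf
  set Eg := ((lev L k : ℕ) : ℂ) • (C'' * lprod g L - 1) - lineMean (L * lev L k) L g with hEg
  have hd : dconnTower L M R k μ i = ((lev L k : ℕ) : ℂ) • (lineMean (L * lev L k) L f - lineMean (L * lev L k) L g)
      + ((lev L k : ℕ) : ℂ) • (Ef - Eg) := by
    rw [dconnTower, connTower_eq, connTower_eq, hstruct, hstruct'', ← smul_add, hEf, hEg]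
    congr 1; abel
  -- (2) the line means' difference = the double line average of the level-(k+1) derivative (§3)
  have hv := smul_lineMean_sub_lineMean_eq L M R k μ s i.2
  -- (3) the double average vs the block average (§3)
  have hbv := norm_bavg_sub_doubleAvg_le L M (k := k) (dconnTower L M R (k + 1) μ) hlip0 hlipa μ i j₀
  have hbv' : (2 * (d : ℝ) + 2) * L * (βD' / ((L * lev L k : ℕ) : ℝ)) = (2 * d + 2) * βD' / (lev L k : ℕ) := by
    rw [hℓ'eq]; field_simp
  -- (4) the corrected remainders' difference (§1, scaled by `ℓ²`)
  have hE : ‖((lev L k : ℕ) : ℂ) • (Ef - Eg)‖ ≤ Real.exp (α / (lev L k : ℕ)) * (κ₁ + κ * β / (lev L k : ℕ) + α * β) / (lev L k : ℕ) := by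
    have hrem := norm_corrRem_sub_corrRem_le (n := L) hef heg hδ hC'' hCC
    have hEE : Ef - Eg = ((lev L k : ℕ) : ℂ) • ((C * lprod f L - 1 - ∑ t ∈ Finset.range L, (f t - 1))
        - (C'' * lprod g L - 1 - ∑ t ∈ Finset.range L, (g t - 1))) := by
      rw [hEf, hEg, lineMean_eq_smul_sum hL, lineMean_eq_smul_sum hL, ← smul_sub, ← smul_sub, ← smul_sub]
    rw [hEE, smul_smul, norm_smul, norm_mul, Complex.norm_natCast]
    refine (mul_le_mul_of_nonneg_left hrem (by positivity)).trans ?_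
    have hpow : (1 + α / ((L * lev L k : ℕ) : ℝ)) ^ L ≤ Real.exp (α / (lev L k : ℕ)) := by
      calc (1 + α / ((L * lev L k : ℕ) : ℝ)) ^ L ≤ (Real.exp (α / ((L * lev L k : ℕ) : ℝ))) ^ L :=
            pow_le_pow_left₀ (by positivity) (by rw [add_comm]; exact Real.add_one_le_exp _) L
        _ = Real.exp (L * (α / ((L * lev L k : ℕ) : ℝ))) := by rw [← Real.exp_nat_mul]
        _ = Real.exp (α / (lev L k : ℕ)) := by congr 1; rw [hℓ'eq]; field_simp
    have hbr : κ₁ / ((lev L k : ℕ) : ℝ) ^ 3 + κ / ((lev L k : ℕ) : ℝ) ^ 2 * (L * (L * (β / ((L * lev L k : ℕ) : ℝ) / ((L * lev L k : ℕ) : ℝ))))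
          + (L : ℝ) ^ 2 * (α / ((L * lev L k : ℕ) : ℝ)) * (L * (β / ((L * lev L k : ℕ) : ℝ) / ((L * lev L k : ℕ) : ℝ)))
        = (κ₁ + κ * β / (lev L k : ℕ) + α * β) / ((lev L k : ℕ) : ℝ) ^ 3 := by
      rw [hℓ'eq]; field_simp
    have hnn : 0 ≤ (κ₁ + κ * β / (lev L k : ℕ) + α * β) / ((lev L k : ℕ) : ℝ) ^ 3 := by positivity
    rw [hbr]
    calc ((lev L k : ℕ) : ℝ) * (lev L k : ℕ) * ((1 + α / ((L * lev L k : ℕ) : ℝ)) ^ L * ((κ₁ + κ * β / (lev L k : ℕ) + α * β) / ((lev L k : ℕ) : ℝ) ^ 3))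
        ≤ ((lev L k : ℕ) : ℝ) * (lev L k : ℕ) * (Real.exp (α / (lev L k : ℕ)) * ((κ₁ + κ * β / (lev L k : ℕ) + α * β) / ((lev L k : ℕ) : ℝ) ^ 3)) :=
          mul_le_mul_of_nonneg_left (mul_le_mul_of_nonneg_right hpow hnn) (by positivity)
      _ = Real.exp (α / (lev L k : ℕ)) * (κ₁ + κ * β / (lev L k : ℕ) + α * β) / (lev L k : ℕ) := by
          field_simp
  -- (5) assemble
  have hfin : bavg (lev L k) L M (dconnTower L M R (k + 1) μ) i - dconnTower L M R k μ i
      = (bavg (lev L k) L M (dconnTower L M R (k + 1) μ) i - (((L : ℕ) : ℂ)⁻¹ * ((L : ℕ) : ℂ)⁻¹) • ∑ t ∈ Finset.range L, ∑ u ∈ Finset.range L,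
          dconnTower L M R (k + 1) μ (s + tstep (fine (L * lev L k) M) μ t - tstep (fine (L * lev L k) M) μ u, i.2))
        - ((lev L k : ℕ) : ℂ) • (Ef - Eg) := by
    rw [hd, hv]; abel
  rw [hfin, add_div, ← hbv']
  exact (norm_sub_le _ _).trans (add_le_add hbv hE)

end Tower

end Summit.QuantumFields.BalabanUV.T4Continuum.B13ReadingsAvgTowerSecondBavg

end
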